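import Literature.AnabelianGeometry.AbsoluteAnabelian.AbsAnabProp121viiBrauerRoute
import Literature.AnabelianGeometry.AbsoluteAnabelian.AbsAnabProp121viiUnramifiedInflation
import Literature.AnabelianGeometry.AbsoluteAnabelian.AbsAnabProp121viiInvariantMapProofs
import Literature.AnabelianGeometry.AbsoluteAnabelian.LocalUnramifiedValuation
import Literature.NumberTheory.GaloisRepresentations.CorNaturality
import HarnessLib

/-!
# [AbsAnab] Prop 1.2.1 (vii), sub-DAG row L05′ `InvariantMapIsBrauerComposite` — the agreement

Proof-only file (abc-iut cell, layer L4; sub-DAG `plan/L4/SUBDAG-AbsAnab-Prop121vii.md`, row L05′,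
statements holder abc-iut-w5-d198).  S. Mochizuki, *The Absolute Anabelian Geometry of Hyperbolic
Curves* (2004) [AbsAnab], proof of Prop 1.2.1 (vii), p. 11 l. 59 – p. 12 l. 2: the residue map
`H²(K, μ_{ℚ/ℤ}(K̄)) ⥲ ℚ/ℤ` is the composite of (N1) `H²(G_K, μ_{ℚ/ℤ}(K̄)) ⥲ H²(G_K, K̄^×)` (Kummer),
(N2)⁻¹ for the inflation `H²(Gal(K^unr/K), (K^unr)^×) ⥲ H²(G_K, K̄^×)`, and (N3)
`H²(Gal(K^unr/K), (K^unr)^×) → H²(Gal(K^unr/K), ℤ) = H²(Ẑ, ℤ) = ℚ/ℤ` (valuation, then the Frobenius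
evaluation of the inverse Bockstein).  The sub-DAG typed the residue map at level `n` by the
characterisation `Prop121vii.IsInvariantMap K n inv` (bijective, `inv(κ_n(π) ∪ χ) = 1`); every arrow
of print's chain is now a kernel object: N1 = `cohomologyMap (kummerι K n) 2` (rows L03, and the
`μ_{ℚ/ℤ}`-colimit `KummerTwoTorsion.lean`), N2 = the inflation of `invariantsInclusion (galUnr K)`
(bijective: `infUnramified_two_bijective`, row L04), N3 = `cohomologyMap (unrValuationHom K) 2`
(abc-iut-w5-d214, `LocalUnramifiedValuation.lean`) followed by `H2UnrEquivQModZ`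
(abc-iut-L4-t16, `LocalUnramifiedQuotientH2.lean`).

* `Prop121vii.brauerComposite_eq_neg_invariantMap` — **row L05′ PROVED (the agreement)**: for every
  `n ≥ 1`, every residue map `inv` in the sense of `IsInvariantMap K n` and every
  `c ∈ H²(G_K, μ_n(K̄))`, print's composite `N3 ∘ N2⁻¹ ∘ N1` takes the value `−(inv c)/n ∈ ℚ/ℤ` on
  `c`.  That is: the characterised residue maps of the sub-DAG ARE print's residue map read in
  `(1/n)ℤ/ℤ ⊆ ℚ/ℤ`, up to the global sign `−1` coming from the cup-product ordering
  `μ_n × μ_n^∨(1)` fixed in `AbsAnabProp121viiSub.lean` (Serre's `(χ, b) = b ∪ δχ` pairs in the other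
  order; recorded on 2026-08-26 by abc-iut-w5-d198 / abc-iut-L6-d2) — a convention shared by `K₁`
  and `K₂`, hence immaterial to Prop 1.2.1 (vii).  Proof: `H²(G_K, μ_n)` is generated by the
  canonical class, on which the chain was computed in `AbsAnabProp121viiBrauerRoute.lean`
  (`brauerRoute_canonicalClass`: Kummer image `−Inf(s_* w)`, `H2UnrEquivQModZ w = 1/n`), and
  `v ∘ s = id` for the uniformiser section (`unrUniformizerSection_comp_unrValuationHom`).

No hypothesis on the units of `K^unr` is needed for this VALUE statement (their acyclicity, row
P32.i.L03 / brick U of abc-iut-w5-d214, is what makes N3's valuation arrow injective).  HONEST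
FRAMING: classical local class field theory (Serre, *Local Fields* XIII §3, XIV §1); kernel-checking an
undisputed step.  Nothing here bears on [IUTchIII] Cor. 3.12.

## References
* [MochizukiAbsAnab2004] S. Mochizuki, *The absolute anabelian geometry of hyperbolic curves* (2004),
  Prop 1.2.1 (vii), proof p. 11–12.
* [SerreLocalFields1979] J.-P. Serre, *Local Fields*, GTM 67 (1979), XIII §3, XIV §1 Prop. 2–3.
-/

noncomputable section

universe u

namespace Literature.AnabelianGeometry.AbsoluteAnabelian

namespace Prop121vii

open Field CategoryTheory ValuativeRel ContRepresentation
open Literature.NumberTheory.GaloisRepresentations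
open Literature.NumberTheory.GaloisRepresentations.DiscreteGaloisModule
open Literature.NumberTheory.GaloisRepresentations.IsNonarchimedeanLocalField
open Literature.NumberTheory.GaloisRepresentations.LocalWeilDatum

variable (K : Type u) [Field K] [ValuativeRel K] [TopologicalSpace K] [IsNonarchimedeanLocalField K]
  [CharZero K]

/-- `k/n = k · (1/n)` in `ℚ/ℤ` (coefficient form). [folklore] -/
private theorem toQModZ_mk_div (n k : ℕ) :
    QCoeff.toQModZ (QCoeff.mk.{u} ((k : ℚ) / n)) = k • QCoeff.toQModZ (QCoeff.mk.{u} ((1 : ℚ) / n)) := by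
  rw [← map_nsmul]
  congr 1
  apply QCoeff.val_injective
  rw [QCoeff.val_mk, ← natCast_zsmul, QCoeff.val_zsmul, QCoeff.val_mk, zsmul_eq_mul, Int.cast_natCast,
    mul_one_div]

/-- **[AbsAnab] Prop 1.2.1 (vii), row L05′ `InvariantMapIsBrauerComposite` — PROVED (value form).**
Let `K` be an MLF (valued form, characteristic `0`), `n ≥ 1`, `φ` an arithmetic Frobenius,
`inv : H²(G_K, μ_n(K̄)) → ℤ/n` a residue map in the sense of `Prop121vii.IsInvariantMap K n`.  Then for
every `c ∈ H²(G_K, μ_n(K̄))`, print's chain — Kummer map to `Br(K) = H²(G_K, K̄^×)` (N1), inverse of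
the bijective inflation from `H²(Gal(K^unr/K), (K̄^×)^{I_K})` (N2), valuation to
`H²(Gal(K^unr/K), ℤ)` and «`H²(Ẑ, ℤ) = ℚ/ℤ`» (N3) — takes the value `−(inv c)/n` in `ℚ/ℤ`: the
characterised residue map IS print's residue map on `(1/n)ℤ/ℤ`, up to the global sign of the
sub-DAG's cup-product ordering. [cite: MochizukiAbsAnab2004, Prop 1.2.1 (vii) p.11] -/
theorem brauerComposite_eq_neg_invariantMap {n : ℕ} [NeZero n] [Finite (MuCarrier K n)]
    {φF : absoluteGaloisGroup K} (hφF : IsFrobPow φF 1)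
    (inv : galoisCohomology (mu K n) 2 →+ ZMod n) (hinv : IsInvariantMap K n inv)
    (c : galoisCohomology (mu K n) 2) :
    H2UnrEquivQModZ hφF (cohomologyMap (unrValuationHom K) 2
      ((AddEquiv.ofBijective
          (ContinuousCohomology.map (ContinuousMonoidHom.quotientMk (galUnr K))
            (invariantsInclusion (galUnr K) (units K)) 2).hom
          (infUnramified_two_bijective K)).symm (cohomologyMap (kummerι K n) 2 c))) =
      - QCoeff.toQModZ (QCoeff.mk (((inv c).val : ℚ) / n)) := by
  obtain ⟨hbij, hnorm⟩ := hinv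
  -- print's chain as ONE additive map `P` on the carrier of `H²(G_K, μ_n)`
  let infE := AddEquiv.ofBijective
      (ContinuousCohomology.map (ContinuousMonoidHom.quotientMk (galUnr K))
        (invariantsInclusion (galUnr K) (units K)) 2).hom (infUnramified_two_bijective K)
  -- the valuation arrow, spelled on `ContinuousRep.quotientInvariants` (definitionally `unrValuationHom`)
  let v : (ContinuousRep.quotientInvariants (galUnr K) (units K)).toTopRep ⟶
      (ContinuousRep.trivial (absoluteGaloisGroup K ⧸ galUnr K) ℤ ZCoeff.{u}).toTopRep :=
    unrValuationHom K
  let P : continuousCohomology 2 (mu K n).toTopRep →+ QModZCoeff.{u} :=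
    (H2UnrEquivQModZ hφF).toAddMonoidHom.comp
      ((cohomologyMap v 2).hom.toLinearMap.toAddMonoidHom.comp
        (infE.symm.toAddMonoidHom.comp (cohomologyMap (kummerι K n) 2).hom.toLinearMap.toAddMonoidHom))
  have hP : ∀ x, P x = H2UnrEquivQModZ hφF (cohomologyMap v 2
      (infE.symm (cohomologyMap (kummerι K n) 2 x))) := fun _ => rfl
  let ιn : continuousCohomology 2 (mu K n).toTopRep →+ ZMod n := inv
  let c' : continuousCohomology 2 (mu K n).toTopRep := c
  change P c' = - QCoeff.toQModZ (QCoeff.mk (((ιn c').val : ℚ) / n))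
  -- the degenerate level `n = 1`
  rcases Nat.lt_or_ge 1 n with hn1 | hn1
  swap
  · have hn : n = 1 := le_antisymm hn1 (NeZero.pos n)
    subst hn
    haveI : Subsingleton (continuousCohomology 2 (mu K 1).toTopRep) :=
      (Nat.card_eq_one_iff_unique.1 (natCard_galoisCohomology_two_mu K 1)).1
    rw [Subsingleton.elim c' 0, map_zero, map_zero, ZMod.val_zero, Nat.cast_zero, zero_div]
    have h0 : QCoeff.mk.{u} 0 = 0 := QCoeff.val_injective (by rw [QCoeff.val_mk, QCoeff.val_zero])
    rw [h0, map_zero, neg_zero]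
  -- the canonical class: uniformiser `ϖ`, its invariant `u`, normalised character `ψ`, cocycle `g`
  have hϖ := irreducible_unrUniformizer K
  have hϖ0 : ((unrUniformizer K : 𝒪[K]) : K) ≠ 0 := Subtype.coe_injective.ne hϖ.ne_zero
  have hϖu : (valuation K).IsUniformizer ((unrUniformizer K : 𝒪[K]) : K) :=
    (ord_eq_one_iff K hϖ0).1 (ord_eq_one_of_irreducible K hϖ)
  let u : (units K).toTopRep.ρ.invariants :=
    ⟨(baseInvariant K _ hϖ0 : ContinuousRep.invariantsOf (galUnr K) (units K)),
      fun σ => units_apply_baseInvariant K _ hϖ0 σ⟩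
  have huval : (unitsVal K (u : UnitsCarrier K) : AlgebraicClosure K) =
      algebraMap K (AlgebraicClosure K) ((unrUniformizer K : 𝒪[K]) : K) :=
    coe_unitsVal_baseInvariant K _ hϖ0
  obtain ⟨ψ, hI, hF, -, -⟩ := exists_normalizedCharacter K n hn1
  have hg : IsNormalizedUnramifiedCocycle K n (scalarCocycle ψ) :=
    isNormalizedUnramifiedCocycle_scalarCocycle K ψ hI hF
  -- `c₀ = κ_n(u) ∪ [g]` has `inv c₀ = 1` and generates
  set c₀ : continuousCohomology 2 (mu K n).toTopRep :=
    ((mu K n).tateDualPairing n).cupProduct ((isSES_kummer K n (NeZero.pos n)).δ₀ u)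
      (oneCocycleClass _ (scalarCocycle ψ)) with hc₀def
  have h1 : ιn c₀ = 1 := hnorm (scalarCocycle ψ) hg _ hϖu u huval
  have hgen : c' = (ιn c').val • c₀ := hbij.1 (by
    show ιn c' = ιn _
    rw [map_nsmul, h1, nsmul_eq_mul, mul_one, ZMod.natCast_zmod_val])
  -- print's chain on the canonical class: `−1/n`
  obtain ⟨s, w, hs, hw, hc₀⟩ := brauerRoute_canonicalClass K hφF ψ hI (hF φF hφF) (scalarCocycle ψ)
    (scalarCocycle_apply ψ) u
  -- `s` is the uniformiser section of `LocalUnramifiedValuation`, so `v ∘ s = 𝟙`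
  have hss : s = unrUniformizerSection K hϖ := by
    ext k
    change (((s.hom k : ContinuousRep.invariantsOf (galUnr K) (units K))) : UnitsCarrier K) =
      ((k.down • baseInvariant K _ hϖ0 : ContinuousRep.invariantsOf (galUnr K) (units K)) :
        UnitsCarrier K)
    rw [hs, Submodule.coe_smul]
  have hsv : s ≫ v = 𝟙 _ := by
    rw [hss]
    exact unrUniformizerSection_comp_unrValuationHom K hϖ
  have hmap : cohomologyMap (𝟙 ((ContinuousRep.trivial (absoluteGaloisGroup K ⧸ galUnr K) ℤ
      ZCoeff.{u}).toTopRep)) 2 = 𝟙 _ :=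
    ContinuousCohomology.map_id _ 2
  have hvs : cohomologyMap v 2 (cohomologyMap s 2 w) = w := by
    rw [← cohomologyMap_comp_apply, hsv, hmap]
    rfl
  have hP₀ : P c₀ = - QCoeff.toQModZ (QCoeff.mk ((1 : ℚ) / n)) := by
    rw [hP, hc₀, map_neg, map_neg, map_neg, neg_inj]
    have hinf : infE.symm (ContinuousCohomology.map (ContinuousMonoidHom.quotientMk (galUnr K))
        (invariantsInclusion (galUnr K) (units K)) 2 (cohomologyMap s 2 w)) = cohomologyMap s 2 w :=
      infE.symm_apply_eq.2 rfl
    rw [hinf, hvs, hw]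
  -- conclude by additivity
  rw [hgen, map_nsmul, hP₀, smul_neg, map_nsmul, h1, toQModZ_mk_div]
  congr 2
  rw [nsmul_eq_mul, mul_one, ZMod.natCast_zmod_val]

end Prop121vii

end Literature.AnabelianGeometry.AbsoluteAnabelian

end
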